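import Mathlib.Algebra.Module.ZMod
import Mathlib.Algebra.Ring.Action.Field
import Mathlib.Data.Finsupp.SMul
import Mathlib.RepresentationTheory.Basic
import Literature.NumberTheory.DiophantineGeometry.FunctionFieldDivisorClasses
import Literature.NumberTheory.DiophantineGeometry.FunctionFieldDivisorsOrdProofs
import Literature.NumberTheory.EllipticCurves.GaloisAction
import HarnessLib

/-!
# Field automorphisms acting on places, divisors and divisor classes; the `n`-torsion of the
# divisor class group as a representation

For a field extension `F/K` the tree's Stichtenoth library
(`Literature.NumberTheory.DiophantineGeometry.AlgFunctionField`, files `FunctionFieldDivisors`,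
`FunctionFieldDivisorClasses`) provides the places `PlaceOver K F`, the divisor group
`Divisor K F = PlaceOver K F →₀ ℤ`, principal divisors `principalDivisor K x`, the subgroup
`principalDivisors K F` and the divisor class group `DivisorClass K F = Div ⧸ Princ`.

Here a group `G` acting on `F` by ring automorphisms (`MulSemiringAction G F`) and mapping the
constant field into itself (the mixin `IsConstantStable G K F`; automatic when `G` acts
`K`-linearly, `IsConstantStable.of_smulCommClass`, and proved for the *semilinear* action of
`Gal(K̄/K)` on `K̄(C)` in `SuperellipticFunctionField`) is made to act:

* on places, `g • v` = the place with valuation ring `g(O_v)` (Mathlib's pointwise action on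
  `ValuationSubring F`; the DVR property is transported along `O_v ≃+* g(O_v)`,
  `valuationSubringSMulEquiv`) — Stichtenoth Lemma 3.5.2 "automorphisms permute the places";
  `instMulActionPlaceOver`, with `PlaceOver.ord_smul_smul : ord_{g v}(g x) = ord_v(x)` (this and
  `PlaceOver.ord_smul`, `Divisor.IsPrincipal.smul` are deliberate dot-notation extensions, declared
  with their absolute names in the `AlgFunctionField` namespace of `DiophantineGeometry`);
* on divisors (Mathlib's `Finsupp.comapDistribMulAction`, enabled locally), with
  `smul_principalDivisor : g • (x) = (g x)`, hence `principalDivisors` is `G`-stable;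
* on divisor classes (`divisorClassDistribMulAction`, a `def` — it is made an instance only on
  the type synonyms of the files using it, like `WeierstrassCurve.geomPoints`), and on the
  `n`-torsion `Cl(F/K)[n]` (Mathlib `AddSubgroup.torsionBy`, the action restricted by the tree's
  `Literature.NumberTheory.EllipticCurves.AddSubgroup.torsionBy.instDistribMulAction`), packaged
  as the `ℤ/n`-linear representation `divisorClassTorsionRep`.

For `K = k̄` algebraically closed and `F = k̄(C)` the function field of a smooth projective
curve, `Cl(F/k̄) = Pic(C_{k̄})` and its degree-zero part is `J(C)(k̄)` (Milne, *Jacobian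
varieties*, Thm. 1.1 and §1); torsion classes have degree zero, so `Cl(F/k̄)[n] = J(C)[n]`, and
`divisorClassTorsionRep` is the Galois module `J[n]` once `G = Gal(k̄/k)` acts on `F = k̄(C)`
through the second factor of `k̄ ⊗_k k(C)` (file `SuperellipticTorsionRep`).

## Mathlib / tree declarations used

`ValuationSubring.pointwiseMulAction` (scoped `Pointwise`), `IsDiscreteValuationRing.addVal_def'`,
`IsDiscreteValuationRing.eq_unit_mul_pow_irreducible`,
`IsDiscreteValuationRing.RingEquivClass.isDiscreteValuationRing`, `MulEquiv.irreducible_iff`,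
`Finsupp.comapDistribMulAction`, `QuotientAddGroup.map`, `AddSubgroup.torsionBy.zmodModule`,
`AddMonoidHom.toZModLinearMap`; tree: `PlaceOver.ord_of_mem`, `PlaceOver.ord_of_not_mem`,
`principalDivisor_apply`.  No Mathlib instance is overridden: the only global instances declared
are on the tree's `PlaceOver` and on `↥(g • O)` for `O : ValuationSubring F`; the `local instance`
attributes below only switch on, inside this file, Mathlib's deliberately non-instance `def`s
`Finsupp.comapSMul/comapMulAction/comapDistribMulAction` (action on the *domain* of a `Finsupp`)
and `AddSubgroup.torsionBy.zmodModule` (the tree-wide idiom, cf. `SwanConductorTorsionProofs`),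
plus this file's own `divisorClassDistribMulAction`.

## References

* H. Stichtenoth, *Algebraic Function Fields and Codes*, 2nd ed., GTM 254 (2009), Lemma 3.5.2
  (automorphisms transport places and valuations), Def. 1.4.3 (principal divisors, `Cl(F/K)`).
* J. S. Milne, *Jacobian varieties*, in: Arithmetic Geometry (Storrs 1984), Springer 1986,
  Thm. 1.1, §1 (`J(k̄) = Pic⁰(C_{k̄})`).
-/

noncomputable section

open scoped Pointwise AddSubgroup

namespace Literature.NumberTheory.GaloisRepresentations

open Literature.NumberTheory.DiophantineGeometry.AlgFunctionField

universe u v w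

/-! ### Actions stabilising the constant field -/

/-- Mixin: the action of `G` on the `K`-algebra `F` maps (the image of) the constant field `K`
into itself, `g • K ⊆ K`.  This is what is needed for `G` to permute the places of `F/K`.
It holds for `K`-linear actions (`of_smulCommClass`) and for the semilinear action of `Gal(K̄/K)`
on `K̄(C)` with `K` replaced by `K̄`. [folklore] -/
class IsConstantStable (G : Type w) (K : Type u) (F : Type v) [CommSemiring K] [Semiring F]
    [Algebra K F] [SMul G F] : Prop where
  /-- `g • c` is again a constant. -/
  smul_algebraMap_mem_range : ∀ (g : G) (c : K), g • algebraMap K F c ∈ Set.range (algebraMap K F)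

/-- A `K`-linear action by ring automorphisms fixes the constants, hence stabilises them. [folklore] -/
instance IsConstantStable.of_smulCommClass (G : Type w) (K : Type u) (F : Type v) [CommSemiring K]
    [Semiring F] [Algebra K F] [Monoid G] [MulSemiringAction G F] [SMulCommClass G K F] :
    IsConstantStable G K F :=
  ⟨fun g c => ⟨c, by rw [Algebra.algebraMap_eq_smul_one, smul_comm g c (1 : F), smul_one]⟩⟩

/-! ### Transport of discrete valuation rings and of `addVal` along ring isomorphisms -/

/-- The additive valuation of a DVR is invariant under ring isomorphisms:
`addVal_B (e a) = addVal_A a` (write `a = u ϖⁿ`; `e ϖ` is a uniformizer of `B`). [folklore] -/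
theorem addVal_map_ringEquiv {A B : Type*} [CommRing A] [IsDomain A] [IsDiscreteValuationRing A]
    [CommRing B] [IsDomain B] [IsDiscreteValuationRing B] (e : A ≃+* B) (a : A) :
    IsDiscreteValuationRing.addVal B (e a) = IsDiscreteValuationRing.addVal A a := by
  rcases eq_or_ne a 0 with rfl | ha
  · rw [map_zero, IsDiscreteValuationRing.addVal_zero, IsDiscreteValuationRing.addVal_zero]
  obtain ⟨ϖ, hϖ⟩ := IsDiscreteValuationRing.exists_irreducible A
  obtain ⟨n, u, rfl⟩ := IsDiscreteValuationRing.eq_unit_mul_pow_irreducible ha hϖ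
  rw [IsDiscreteValuationRing.addVal_def' u hϖ n, map_mul, map_pow,
    show e (u : A) = ((Units.map (e : A →* B) u : Bˣ) : B) from rfl,
    IsDiscreteValuationRing.addVal_def' _ ((MulEquiv.irreducible_iff e).2 hϖ) n]

section Field

variable {K : Type u} {F : Type v} [Field K] [Field F] [Algebra K F]
variable {G : Type w} [Group G] [MulSemiringAction G F]

/-- The ring isomorphism `O ≃+* g(O)`, `x ↦ g • x`, between a valuation subring and its image
under the pointwise action (Stichtenoth Lemma 3.5.2). [cite: Stichtenoth2009, Lemma 3.5.2] -/
def valuationSubringSMulEquiv (g : G) (O : ValuationSubring F) :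
    O ≃+* (g • O : ValuationSubring F) where
  toFun x := ⟨g • (x : F), ValuationSubring.smul_mem_pointwise_smul g _ O x.2⟩
  invFun y := ⟨g⁻¹ • (y : F), ValuationSubring.mem_pointwise_smul_iff_inv_smul_mem.mp y.2⟩
  left_inv x := Subtype.ext (inv_smul_smul g (x : F))
  right_inv y := Subtype.ext (smul_inv_smul g (y : F))
  map_mul' x y := Subtype.ext (smul_mul' g (x : F) y)
  map_add' x y := Subtype.ext (smul_add g (x : F) y)

/-- Unfolding of `valuationSubringSMulEquiv`. [folklore] -/
@[simp]
theorem coe_valuationSubringSMulEquiv (g : G) (O : ValuationSubring F) (x : O) :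
    ((valuationSubringSMulEquiv g O x : (g • O : ValuationSubring F)) : F) = g • (x : F) :=
  rfl

/-- The image `g(O)` of a discrete valuation subring is a discrete valuation ring
(transport along `valuationSubringSMulEquiv`). [folklore] -/
instance instIsDiscreteValuationRingSMul (g : G) (O : ValuationSubring F)
    [IsDiscreteValuationRing O] : IsDiscreteValuationRing (g • O : ValuationSubring F) :=
  IsDiscreteValuationRing.RingEquivClass.isDiscreteValuationRing (valuationSubringSMulEquiv g O)

/-- `g(O) ≠ F` when `O ≠ F`. [folklore] -/
theorem smul_valuationSubring_ne_top (g : G) {O : ValuationSubring F} (hO : O ≠ ⊤) :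
    g • O ≠ ⊤ := by
  intro h
  apply hO
  refine top_unique fun x _ => ?_
  have hx : g • x ∈ g • O := h ▸ ValuationSubring.mem_top (g • x)
  exact ValuationSubring.smul_mem_pointwise_smul_iff.mp hx

/-! ### The action on places -/

variable [IsConstantStable G K F]

/-- **Automorphisms permute the places** (Stichtenoth Lemma 3.5.2): for `g ∈ G` and a place
`v` of `F/K`, `g • v` is the place with valuation ring `g(O_v)`; it contains `K` because `g⁻¹`
maps constants to constants.  A `MulAction` (the pointwise action on valuation subrings is one).
[cite: Stichtenoth2009, Lemma 3.5.2] -/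
instance instMulActionPlaceOver : MulAction G (PlaceOver K F) where
  smul g v :=
    { toValuationSubring := g • v.toValuationSubring
      ne_top := smul_valuationSubring_ne_top g v.ne_top
      isDVR := instIsDiscreteValuationRingSMul g v.toValuationSubring
      algebraMap_mem := fun c => by
        obtain ⟨c', hc'⟩ := IsConstantStable.smul_algebraMap_mem_range (K := K) (F := F) g⁻¹ c
        rw [ValuationSubring.mem_pointwise_smul_iff_inv_smul_mem, ← hc']
        exact v.algebraMap_mem c' }
  one_smul v := PlaceOver.ext (one_smul G v.toValuationSubring)
  mul_smul g h v := PlaceOver.ext (mul_smul g h v.toValuationSubring)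

/-- The valuation ring of `g • v` is `g(O_v)` (definitional). [folklore] -/
@[simp]
theorem toValuationSubring_smul (g : G) (v : PlaceOver K F) :
    (g • v).toValuationSubring = g • v.toValuationSubring :=
  rfl

/-- `g x ∈ O_{g v} ↔ x ∈ O_v`. [folklore] -/
theorem smul_mem_toValuationSubring_smul_iff (g : G) (v : PlaceOver K F) (x : F) :
    g • x ∈ (g • v).toValuationSubring ↔ x ∈ v.toValuationSubring :=
  ValuationSubring.smul_mem_pointwise_smul_iff

/-- **Transport of valuations** (Stichtenoth Lemma 3.5.2): `ord_{g v}(g x) = ord_v(x)`.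
Both branches of the definition of `ord` are values of `addVal` on the DVRs `O_v`, `O_{g v}`,
which correspond under `valuationSubringSMulEquiv` (`addVal_map_ringEquiv`).
[cite: Stichtenoth2009, Lemma 3.5.2] -/
theorem _root_.Literature.NumberTheory.DiophantineGeometry.AlgFunctionField.PlaceOver.ord_smul_smul
    (g : G) (v : PlaceOver K F) (x : F) :
    (g • v).ord (g • x) = v.ord x := by
  by_cases hx : x ∈ v.toValuationSubring
  · have hgx : g • x ∈ (g • v).toValuationSubring := (smul_mem_toValuationSubring_smul_iff g v x).2 hx
    rw [PlaceOver.ord_of_mem _ hgx, PlaceOver.ord_of_mem _ hx]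
    have key : (⟨g • x, hgx⟩ : (g • v).toValuationSubring) =
        valuationSubringSMulEquiv g v.toValuationSubring ⟨x, hx⟩ := rfl
    rw [key, addVal_map_ringEquiv]
  · have hgx : g • x ∉ (g • v).toValuationSubring :=
      fun h => hx ((smul_mem_toValuationSubring_smul_iff g v x).1 h)
    rw [PlaceOver.ord_of_not_mem _ hgx, PlaceOver.ord_of_not_mem _ hx]
    have key : (⟨(g • x)⁻¹, ((g • v).toValuationSubring.mem_or_inv_mem _).resolve_left hgx⟩ :
        (g • v).toValuationSubring) =
        valuationSubringSMulEquiv g v.toValuationSubring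
          ⟨x⁻¹, (v.toValuationSubring.mem_or_inv_mem x).resolve_left hx⟩ :=
      Subtype.ext (smul_inv'' g x).symm
    rw [key, addVal_map_ringEquiv]

/-- `ord_v(g x) = ord_{g⁻¹ v}(x)`. [cite: Stichtenoth2009, Lemma 3.5.2] -/
theorem _root_.Literature.NumberTheory.DiophantineGeometry.AlgFunctionField.PlaceOver.ord_smul
    (g : G) (v : PlaceOver K F) (x : F) :
    v.ord (g • x) = (g⁻¹ • v).ord x := by
  conv_lhs => rw [← smul_inv_smul g v]
  exact PlaceOver.ord_smul_smul g (g⁻¹ • v) x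

/-! ### The action on divisors and on principal divisors -/

attribute [local instance] Finsupp.comapSMul Finsupp.comapMulAction Finsupp.comapDistribMulAction

/-- The induced action on divisors is `(g • D)(v) = D(g⁻¹ v)`, i.e. `g • ∑ n_v v = ∑ n_v (g v)`
(Mathlib's `Finsupp.comapDistribMulAction`, enabled as a local instance in this file). [folklore] -/
theorem smul_divisor_apply (g : G) (D : Divisor K F) (v : PlaceOver K F) :
    (g • D) v = D (g⁻¹ • v) :=
  Finsupp.comapSMul_apply g D v

/-- **The divisor of `g x` is `g` applied to the divisor of `x`**: `g • (x) = (g x)`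
(including the junk case of `principalDivisor`, which is `G`-invariant). Stichtenoth Lemma 3.5.2.
[cite: Stichtenoth2009, Lemma 3.5.2] -/
theorem smul_principalDivisor (g : G) (x : F) :
    g • principalDivisor K x = principalDivisor K (g • x) := by
  classical
  have key : ∀ v : PlaceOver K F, v.ord (g • x) = (g⁻¹ • v).ord x := fun v => PlaceOver.ord_smul g v x
  have hset : {v : PlaceOver K F | v.ord (g • x) ≠ 0} = (fun v => g • v) '' {v | v.ord x ≠ 0} := by
    ext v
    simp only [Set.mem_setOf_eq, Set.mem_image, key]
    constructor
    · intro h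
      exact ⟨g⁻¹ • v, h, smul_inv_smul g v⟩
    · rintro ⟨w, hw, rfl⟩
      rwa [inv_smul_smul]
  by_cases h : {v : PlaceOver K F | v.ord x ≠ 0}.Finite
  · have h' : {v : PlaceOver K F | v.ord (g • x) ≠ 0}.Finite := by
      rw [hset]
      exact h.image _
    ext v
    rw [smul_divisor_apply, principalDivisor_apply h, principalDivisor_apply h', key]
  · have h' : ¬ {v : PlaceOver K F | v.ord (g • x) ≠ 0}.Finite := by
      intro h'
      rw [hset] at h'
      exact h (Set.Finite.of_finite_image h' (MulAction.injective g).injOn)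
    simp only [principalDivisor, dif_neg h, dif_neg h', smul_zero]

/-- Principal divisors go to principal divisors: `g • (x) = (g x)` with `g x ≠ 0`. [folklore] -/
theorem _root_.Literature.NumberTheory.DiophantineGeometry.AlgFunctionField.Divisor.IsPrincipal.smul
    (g : G) {D : Divisor K F} (hD : D.IsPrincipal) :
    (g • D).IsPrincipal := by
  obtain ⟨x, hx, rfl⟩ := hD
  exact ⟨g • x, (smul_ne_zero_iff_ne g).2 hx, (smul_principalDivisor g x).symm⟩

/-- The subgroup `Princ(F/K)` is `G`-stable. [folklore] -/
theorem principalDivisors_le_comap_smul (g : G) :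
    principalDivisors K F ≤
      (principalDivisors K F).comap (DistribSMul.toAddMonoidHom (Divisor K F) g) :=
  (AddSubgroup.closure_le _).2 fun _ hD => AddSubgroup.subset_closure (hD.smul g)

/-! ### The action on divisor classes and on their `n`-torsion -/

/-- The endomorphism `[D] ↦ [g • D]` of `Cl(F/K) = Div ⧸ Princ` induced by `g ∈ G`. [folklore] -/
def divisorClassMap (g : G) : DivisorClass K F →+ DivisorClass K F :=
  QuotientAddGroup.map _ _ (DistribSMul.toAddMonoidHom (Divisor K F) g)
    (principalDivisors_le_comap_smul g)

/-- `g • [D] = [g • D]` (definitional). [folklore] -/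
@[simp]
theorem divisorClassMap_mk (g : G) (D : Divisor K F) :
    divisorClassMap g (DivisorClass.mk D) = DivisorClass.mk (g • D) :=
  rfl

variable (K F G) in
/-- **The action of `G` on the divisor class group** `Cl(F/K)`, `g • [D] = [g • D]`, by group
automorphisms.  A `def` (reducible), not a global instance: files using it put it on their own
type synonym (as the tree does for `WeierstrassCurve.geomPoints`). [folklore] -/
abbrev divisorClassDistribMulAction : DistribMulAction G (DivisorClass K F) where
  smul g c := divisorClassMap g c
  one_smul c := by
    induction c using QuotientAddGroup.induction_on with
    | H D =>
      change divisorClassMap (1 : G) (DivisorClass.mk D) = DivisorClass.mk D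
      rw [divisorClassMap_mk, one_smul]
  mul_smul g h c := by
    induction c using QuotientAddGroup.induction_on with
    | H D =>
      change divisorClassMap (g * h) (DivisorClass.mk D) =
        divisorClassMap g (divisorClassMap h (DivisorClass.mk D))
      rw [divisorClassMap_mk, divisorClassMap_mk, divisorClassMap_mk, mul_smul]
  smul_zero g := map_zero (divisorClassMap g)
  smul_add g := map_add (divisorClassMap g)

attribute [local instance] divisorClassDistribMulAction AddSubgroup.torsionBy.zmodModule

/-- `g • [D] = [g • D]`. [folklore] -/
theorem smul_divisorClassMk (g : G) (D : Divisor K F) :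
    g • DivisorClass.mk D = DivisorClass.mk (g • D) :=
  rfl

variable (K F G) in
/-- **The `n`-torsion of the divisor class group as a `ℤ/n`-linear representation of `G`**:
`g ↦ (c ↦ g • c)` on `Cl(F/K)[n]` (Mathlib `AddSubgroup.torsionBy`, a `ZMod n`-module through
`AddSubgroup.torsionBy.zmodModule`; the action restricts to the torsion by the tree's
`Literature.NumberTheory.EllipticCurves.AddSubgroup.torsionBy.instDistribMulAction`).  For
`F = k̄(C)`, `K = k̄`: the Galois module `J(C)[n]` (Milne, *Jacobian varieties*, Thm. 1.1:
`J(k̄) = Pic⁰(C_{k̄})`; torsion classes have degree `0`). [cite: Milne1986JacobianVarieties, Thm. 1.1] -/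
def divisorClassTorsionRep (n : ℕ) : Representation (ZMod n) G ((DivisorClass K F)[n]) where
  toFun g := (DistribSMul.toAddMonoidHom ((DivisorClass K F)[n]) g).toZModLinearMap n
  map_one' := LinearMap.ext fun c => one_smul G c
  map_mul' g h := LinearMap.ext fun c => mul_smul g h c

/-- Unfolding: `ρ(g) c = g • c`, i.e. on representatives `[D] ↦ [g • D]`. [folklore] -/
@[simp]
theorem divisorClassTorsionRep_apply_coe (n : ℕ) (g : G) (c : (DivisorClass K F)[n]) :
    ((divisorClassTorsionRep K F G n g c : (DivisorClass K F)[n]) : DivisorClass K F) =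
      g • (c : DivisorClass K F) :=
  rfl

end Field

end Literature.NumberTheory.GaloisRepresentations
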